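import Summits.QuantumFields.YangMills.Theorems.UnitScaleTiltProp7LandauDictT3
import Summits.QuantumFields.YangMills.Theorems.UnitScaleTiltProp7SectET3DeltaPiT3
import HarnessLib

/-!
# Route `UnitScaleTilt`, crux «MinimiserStabilityRegPr» (stmt-QuantumFields-19200, stub EX), route (α), node N06(d = 3) — **A LOCATED DISPLAY DEFECT, BY KERNEL: THE CLASS
# `PosPrime …(U₀)` («`Δ′_a(U₀)` positive definite», brick L0b part 2 ✓`Prop7SectET3DeltaPi.PosPrime`) IS EMPTY AT EVERY BACKGROUND `U₀`** — the intrinsic substitute `Q′ := Q(U₀)∘D_{U₀}`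
# of (3.24)'s block average leaves the whole kernel of `D_{U₀}` (at least the constant identity-valued gauge parameter, at EVERY `U₀`) in the kernel of `Δ′_a = D*D + a·(QD)†(QD)`; hence the
# EX display's class row `hN06 : RegPr (α L) U₀ → PosOnto … U₀ ∧ PosPrime … U₀` (✓`stubEX_of_chartPiecesTwS9`) is UNINHABITABLE as typed

Cell `ym3-torus` (HUMAN RULING D-0037, YM ladder rung R3 — YM₃ on T³, NOT d = 4, NOT Clay; YM gap NOT proved), width seat `ym3-torus-px16` (gen 2).  THEOREMS ONLY (0 `def`, 0 `sorry`);
`--supports stmt-QuantumFields-19200 --as helper`; count-neutral; a KERNEL CERTIFICATE about the tree's own letters — nothing of print is refuted (print's (3.24) uses the genuine block average `Q′`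
of the gauge parameters, (3.18), which DOES see the constants; the tree's ACK 32 (q1) «intrinsic» substitution `Q′ := Q∘D` is what empties the class).

THE PRINT.  [Balaban1985BackgroundPropagators] p. 394 (3.24): *«Δ′_a = (Δ^η_U + Q′*aQ′)↾Ω₀»* with `Q′ = Q′_j(U)` the averaging operations FOR GAUGE TRANSFORMATIONS of (3.18)–(3.19) p. 393 (the block
Ad-mean of `λ`, so that `Q′λ = λ` for constant `λ` at `U = 1`); p. 395: *«Assuming some regularity of the configuration U it can be easily shown that the operator Δ′_a is positive»*.
THE TREE.  ✓`Prop7SectET3DeltaPi.laplacePrimeA … U₀ := covLapSite U₀ + a • ((QDS U₀)† ∘ QDS U₀)` with `QDS U₀ = QL2 U₀ ∘ DL2 U₀` (✓`Prop7SectET3GaugeProjector.QDS`), and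
✓`PosPrime … U₀ :⟺ ∀ x ≠ 0, 0 < re ⟪x, laplacePrimeA … U₀ x⟫`.

WHAT IS PROVED (ns `…Theorems.Prop7SectET3PosPrimeVacuous`; member `F n K`, `h : n ≤ K`, weights `c₀ cB a`, ANY background `U₀`):
* `DL2_toL2S_const_eq_zero` — the constant identity-valued gauge parameter `𝟙 := toL2S (fun _ ↦ 1)` is covariantly constant at EVERY background: `D_{U₀} 𝟙 = 0` (`U·1·U⁻¹ − 1 = 0`);
  `toL2S_const_one_ne_zero`; `laplacePrimeA_const_eq_zero` — `Δ′_a(U₀) 𝟙 = 0`.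
* ★★★ **`not_posPrime (U₀) : ¬ PosPrime F n K h c₀ cB a U₀`** — for EVERY member, weights and background.
* ★★ **`not_hN06_at (U₀) : ¬ (PosOnto F n K h c₀ cB a Δx U₀ ∧ PosPrime F n K h c₀ cB a U₀)`** — the conjunction displayed by S9's `hN06` fails pointwise; with ✓`regPr_one` the displayed
  implication `RegPr … (α L) U₀ → …` fails at `U₀ := 1` for every `0 < α L`: ★★ `not_hN06_text`.
CONSEQUENCE (located, for the EX namer ∕ the N06 definer ∕ ★★OWNER): every EX theorem carrying `hq : PosPrime …` or the class row `hN06` (S9 ✓p660931 and its descents, ✓`Prop7HessRowOfEq111`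
§2–§3, ✓`Prop7SectET3LandauOpRows` §3–§5, ✓`Prop7HDsolAtRecordOfRows`, ✓`Prop7H46TwOfN06`, ✓`Prop7SectET3EXJunction.h*_pi_of_N06`, …) is VACUOUSLY TRUE as typed; `GprimeT … U₀ = 0` (junk
branch) at every `U₀`, hence `gaugeCorr = id` and `DeltaPi = DeltaEta` definitionally-in-effect.  THE CURE is a DEFINITIONS change in brick L0b part 2 (review lane, not this file): (C1) print's
(3.24) — `laplacePrimeA := covLapSite + a • (Q′† ∘ Q′)` with `Q′ :=` the `(K−n)`-fold covariant block Ad-average of gauge parameters (the `ns (K−n)` map of ✓`Prop7SymAvgTwSGaugeDir`, onto by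
✓`Prop7CovMeanTowerOnto`), for which positivity at `RegPr` is print's p. 395 sentence (Poincaré on blocks + smallness); or (C2) restrict the class to the orthogonal complement of `ker D_{U₀}` and
let `G′` be the inverse there.  Either way `R_S`∕`N_S` (brick L0c) are unaffected (they only use «`Q(Dλ) = 0` on `N_S`»).
HONEST SCOPE.  A statement about the TREE'S definitions; nothing of [B9] is claimed false; not a refutation of the crux, the stub, or any registered decl; nothing continuum ∕ OS ∕ mass-gap ∕ Clay.

References: T. Bałaban, CMP **99** (1985) 389–434 [Balaban1985BackgroundPropagators] ((3.18)–(3.19) p.393, (3.23)–(3.25) pp.394–395, Thm 3.11 p.416, (3.119) p.419).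
-/

set_option autoImplicit false

noncomputable section

open scoped InnerProductSpace ComplexConjugate Matrix.Norms.L2Operator

namespace Summit.QuantumFields.YangMills.Theorems.Prop7SectET3PosPrimeVacuous

open Literature.MathematicalPhysics.QuantumFieldTheory.Balaban1983to89
open Literature.MathematicalPhysics.QuantumFieldTheory.Balaban1983to89.T3ContinuumYM3Torus
open Literature.MathematicalPhysics.QuantumFieldTheory.Balaban1983to89.T3PrintedRegularMinimiser (RegPr regPr_one)
open T3SectALandauChart (eta covDerivFwdT bgUnits)
open B7Eq78Linearization (conjR conjR_one)
open B11Eq103H1Complex (SiteL2K BondL2K)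
open Summit.QuantumFields.YangMills.Theorems.Prop7SectET3Transport (periodsT3)
open Summit.QuantumFields.YangMills.Theorems.Prop7SectET3HilbertLetters (W₂ toL2 toL2S DL2 DstarL2 covLapSite)
open Summit.QuantumFields.YangMills.Theorems.Prop7SectET3GaugeProjector (QDS QDS_apply)
open Summit.QuantumFields.YangMills.Theorems.Prop7SectET3CurvedPropagators (PosOnto)
open Summit.QuantumFields.YangMills.Theorems.Prop7SectET3DeltaPi (laplacePrimeA PosPrime)
open Summit.QuantumFields.YangMills.Theorems.Prop7LandauDict (DL2_toL2S_eq_covDerivFwdT)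

variable (F : T3Family) (n K : ℕ) (h : n ≤ K) (c₀ cB a : ℝ) [Fact (0 < c₀)] [Fact (0 < cB)]

/-- **THE CONSTANT IDENTITY GAUGE PARAMETER IS COVARIANTLY CONSTANT AT EVERY BACKGROUND**: `D_{U₀}(toL2S 1) = 0` (`U₀(b)·1·U₀(b)⁻¹ − 1 = 0`).
[cite: Balaban1985BackgroundPropagators, (3.3) p.391] -/
theorem DL2_toL2S_const_eq_zero (U₀ : GaugeField (F.P K) 0 (Matrix.specialUnitaryGroup (Fin 2) ℂ)) :
    DL2 F n K c₀ U₀ (toL2S F K c₀ (fun _ : Site (F.P K) 0 => (1 : Matrix (Fin 2) (Fin 2) ℂ))) = 0 := by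
  apply (toL2 F K c₀).symm.injective
  rw [map_zero]
  funext b
  rw [DL2_toL2S_eq_covDerivFwdT, Pi.zero_apply, covDerivFwdT, conjR_one, sub_self, smul_zero]

omit [Fact (0 < c₀)] in
/-- The constant identity gauge parameter is not zero (the torus has a site). [folklore] -/
theorem toL2S_const_one_ne_zero : toL2S F K c₀ (fun _ : Site (F.P K) 0 => (1 : Matrix (Fin 2) (Fin 2) ℂ)) ≠ 0 := by
  intro h0
  have h1 := congrArg (toL2S F K c₀).symm h0
  rw [LinearEquiv.symm_apply_apply, map_zero] at h1
  have h2 := congrFun h1 default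
  simp only [Pi.zero_apply] at h2
  exact one_ne_zero h2

/-- **`Δ′_a(U₀)` KILLS THE CONSTANT IDENTITY GAUGE PARAMETER** at every background: `(D*D + a·(QD)†(QD)) 𝟙 = 0`. [cite: Balaban1985BackgroundPropagators, (3.24) p.394] -/
theorem laplacePrimeA_const_eq_zero (U₀ : GaugeField (F.P K) 0 (Matrix.specialUnitaryGroup (Fin 2) ℂ)) :
    laplacePrimeA F n K h c₀ cB a U₀ (toL2S F K c₀ (fun _ : Site (F.P K) 0 => (1 : Matrix (Fin 2) (Fin 2) ℂ))) = 0 := by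
  rw [laplacePrimeA, LinearMap.add_apply, LinearMap.smul_apply, LinearMap.comp_apply, QDS_apply, covLapSite, LinearMap.comp_apply, DL2_toL2S_const_eq_zero,
    map_zero, map_zero, map_zero, smul_zero, add_zero]

/-- ★★★ **THE CLASS `PosPrime` IS EMPTY AT EVERY BACKGROUND**: `¬ PosPrime F n K h c₀ cB a U₀` — `Δ′_a(U₀)` (with the intrinsic `Q′ := Q∘D`) has the non-zero kernel vector `𝟙`, so
`0 < re⟪𝟙, Δ′_a 𝟙⟫ = 0` is impossible. [cite: Balaban1985BackgroundPropagators, (3.24) p.394, Thm 3.11 p.416] -/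
theorem not_posPrime (U₀ : GaugeField (F.P K) 0 (Matrix.specialUnitaryGroup (Fin 2) ℂ)) : ¬ PosPrime F n K h c₀ cB a U₀ := by
  intro hq
  have h1 := hq.pos _ (toL2S_const_one_ne_zero F K c₀)
  rw [laplacePrimeA_const_eq_zero, inner_zero_right, map_zero] at h1
  exact lt_irrefl _ h1

/-- ★★ **THE CONJUNCTION DISPLAYED BY S9's `hN06` FAILS AT EVERY BACKGROUND AND EVERY HESSIAN SLOT.** [cite: Balaban1985BackgroundPropagators, Thm 3.11 p.416] -/
theorem not_hN06_at (Δx : GaugeField (F.P K) 0 (Matrix.specialUnitaryGroup (Fin 2) ℂ) → (BondL2K ℂ 3 (periodsT3 F K) c₀ W₂ →ₗ[ℂ] BondL2K ℂ 3 (periodsT3 F K) c₀ W₂))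
    (U₀ : GaugeField (F.P K) 0 (Matrix.specialUnitaryGroup (Fin 2) ℂ)) :
    ¬ (PosOnto F n K h c₀ cB a Δx U₀ ∧ PosPrime F n K h c₀ cB a U₀) :=
  fun hN => not_posPrime F n K h c₀ cB a U₀ hN.2

/-- ★★ **S9's `hN06` ROW, READ AT ONE MEMBER, IS UNINHABITABLE**: for `0 < α` the implication «`RegPr F n K α U₀ → PosOnto … U₀ ∧ PosPrime … U₀` for every `U₀`» fails at the flat
background `U₀ := 1` (✓`regPr_one`). [cite: Balaban1985BackgroundPropagators, Thm 3.11 p.416; Balaban1985Variational, (7) p.278] -/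
theorem not_hN06_text (Δx : GaugeField (F.P K) 0 (Matrix.specialUnitaryGroup (Fin 2) ℂ) → (BondL2K ℂ 3 (periodsT3 F K) c₀ W₂ →ₗ[ℂ] BondL2K ℂ 3 (periodsT3 F K) c₀ W₂))
    {α : ℝ} (hα : 0 < α) :
    ¬ (∀ U₀ : GaugeField (F.P K) 0 (Matrix.specialUnitaryGroup (Fin 2) ℂ), RegPr F n K α U₀ → PosOnto F n K h c₀ cB a Δx U₀ ∧ PosPrime F n K h c₀ cB a U₀) :=
  fun hall => not_hN06_at F n K h c₀ cB a Δx 1 (hall 1 (regPr_one hα))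

end Summit.QuantumFields.YangMills.Theorems.Prop7SectET3PosPrimeVacuous

end
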